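import Literature.NumberTheory.EllipticCurves.LatticeEndomorphismOfCurve
import Mathlib.Algebra.MvPolynomial.PDeriv
import HarnessLib

/-!
# An isogeny `E_{Λ₁} → E_{Λ₂}` given by rational functions is `z ↦ αz` with `αΛ₁ ⊆ Λ₂`

Topic `NumberTheory/EllipticCurves`; companion of `LatticeEndomorphismOfCurve.lean`, which
treats *endomorphisms* of one curve `E_Λ` (the bridge `End(E) ↪ End(Λ)`, Silverman, *AEC*,
Thm. VI.5.3).  This file proves the two-lattice statement behind Silverman, *AEC*, Thm. VI.4.1(b)
— a homomorphism `E_{Λ₁}(ℂ) ⊇ M₁ → M₂ ⊆ E_{Λ₂}(ℂ)` which is given off a finite set by a rational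
map `(x, y) ↦ (p₁/q₁, p₂/q₂)(x, y)` is, through the parametrisations `z ↦ (℘(z), ℘'(z)/2)`,
the map `z ↦ αz` for one `α ∈ ℂ` with `αΛ₁ ⊆ Λ₂` — in the elementary, local form used by the
tree (no complex structure on `E(ℂ)` is available, and in the application `M₁ = E(ℚ̄)` is only
a dense subgroup): a local holomorphic lift near a generic division point
(`PeriodPair.exists_local_lift`) is affine by additivity (`PeriodPair.exists_eq_affine_of_lifts`),
the identity theorem turns `℘_{Λ₂}(αz + β) = (p₁/q₁)(℘_{Λ₁} z, ℘'_{Λ₁} z/2)` into `αΛ₁ ⊆ Λ₂`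
(`mul_mem_lattice_of_weierstrassP_affine_eq₂`), and additivity spreads `Ψ(z) ≡ αz` from a
neighbourhood to the whole group.

In addition the multiplier `α` is computed **algebraically**: differentiating
`℘_{Λ₂}(αz + β) = (p₁/q₁)(x(z), y(z))` with `x = ℘_{Λ₁}`, `y = ℘'_{Λ₁}/2`, `x' = 2y`,
`y' = 3x² − g₂/4` and using `℘'_{Λ₂}(αz + β) = 2(p₂/q₂)(x, y)` gives
`α · 2p₂q₁² = (δp₁·q₁ − p₁·δq₁)·q₂` at `(x(z), y(z))` for **every** `z ∉ Λ₁` (identity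
theorem), where `δ = WeierstrassCurve.invariantDerivation` is the derivation `f ↦ df/ω` of the
coordinate ring (`ω = dx/(2y + a₁x + a₃)` the invariant differential; Silverman, *AEC*, III.5,
`(2y + a₁x + a₃)dy = (3x² + 2a₂x + a₄ − a₁y)dx`).  This is the coordinate form of
`ψ^*(dx'/2y') = α · dx/2y` (pull-back of the invariant differential, *AEC* III.5) and is what
makes `α` rational over the field of definition of the isogeny in the sequel
`EichlerShimuraConstructionLatticeProofs.lean`.

## Main statements

Deliberate dot-notation extensions of Mathlib's `WeierstrassCurve` (the derivation) and
`PeriodPair` (everything analytic, as in the sibling files `ComplexTorus.lean`,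
`LatticeEndomorphism*.lean`); the generic chain rule lives in
`namespace Literature.NumberTheory.EllipticCurves`.

* `WeierstrassCurve.invariantDerivation W` (definition): `δf = ∂ₓf·(2y + a₁x + a₃) +
  ∂_yf·(3x² + 2a₂x + a₄ − a₁y)` on `R[x, y]`; `invariantDerivation_map` (base change);
  `Literature.NumberTheory.EllipticCurves.hasDerivAt_mvPolynomial_eval` (chain rule);
  `PeriodPair.hasDerivAt_eval_weierstrassP`: `d/dz f(℘(z), ℘'(z)/2) = (δf)(℘(z), ℘'(z)/2)`
  for `E_Λ`.
* `mul_mem_lattice_of_weierstrassP_affine_eq₂`: `N(ζ) = ℘_{Λ₂}(c' + αζ)·D(ζ)` near a point, for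
  `Λ₁`-periodic `N, D` analytic off `Λ₁`, forces `αΛ₁ ⊆ Λ₂`.
* `exists_mul_of_rational_lift₂`: the analytic core for a map `Ψ` on a subgroup `G ≤ ℂ`
  containing the division points of `Λ₁`, additive modulo `Λ₂` and rational in
  `(℘_{Λ₁}, ℘'_{Λ₁}/2)` off finitely many cosets: `∃ α, αΛ₁ ⊆ Λ₂ ∧ Ψ ≡ α· (mod Λ₂)` on `G`.
* `mul_eval_eq_of_rational_of_linear`: for such a `Ψ ≡ α·`, the identity
  `α · 2p₂q₁² = (δp₁·q₁ − p₁·δq₁)·q₂` along `z ↦ (℘_{Λ₁} z, ℘'_{Λ₁} z/2)`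
  (`exists_eq_const_of_sub_mem_lattice`: a continuous function `Λ`-valued on a dense subset of
  a ball is constant).
* `exists_mul_of_curve_hom`: the form used downstream — abstract groups `Mᵢ ↪ E_{Λᵢ}(ℂ)` (image
  of `M₁` containing the torsion), `φ : M₁ →+ M₂` with finite kernel and rational off a finite
  set: `∃ α ≠ 0, αΛ₁ ⊆ Λ₂`, and the displayed identity at every affine point of `M₁` for
  *every* rational representation of `φ`.

## References

* J. H. Silverman, *The Arithmetic of Elliptic Curves*, 2nd ed., GTM 106, Springer 2009:
  Thm. VI.4.1 (PDF pp. 152–154: holomorphic maps `ℂ/Λ₁ → ℂ/Λ₂` with `φ(0) = 0` are the `φ_α`,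
  `αΛ₁ ⊆ Λ₂`, and these are exactly the isogenies), Thm. VI.5.3 (PDF pp. 155–156), III.5
  (PDF p. 75: `(2y + a₁x + a₃)dy = (3x² + 2a₂x + a₄ − a₁y)dx`). [SilvermanAEC2009]
-/

noncomputable section

open Complex Filter Topology Set

/-! ### The derivation `f ↦ df/ω` of the coordinate ring -/

namespace WeierstrassCurve

variable {R : Type*} [CommRing R]

/-- **The derivation `f ↦ df/ω` of `R[x, y]` attached to a Weierstrass curve**, `ω` the invariant
differential `dx/(2y + a₁x + a₃)`: since `dx = (2y + a₁x + a₃) ω` and, on the curve,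
`dy = (3x² + 2a₂x + a₄ − a₁y) ω` (Silverman, *AEC*, III.5, proof of Thm. III.5.2:
"`(2yᵢ + a₁xᵢ + a₃)dyᵢ = (3xᵢ² + 2a₂xᵢ + a₄ − a₁yᵢ)dxᵢ`"), one has `df = (δf) ω` with
`δf = ∂f/∂x · (2y + a₁x + a₃) + ∂f/∂y · (3x² + 2a₂x + a₄ − a₁y)` (variable `0` is `x`,
variable `1` is `y`).  Analytically, for `E_Λ` and `(x, y) = (℘(z), ℘'(z)/2)` (so `ω = dz`),
`δ` is `d/dz` (`PeriodPair.hasDerivAt_eval_weierstrassP`). A deliberate dot-notation extension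
of Mathlib's `WeierstrassCurve`. [cite: SilvermanAEC2009, III.5 (proof of Thm. III.5.2, PDF p. 75)] -/
def invariantDerivation (W : WeierstrassCurve R) (f : MvPolynomial (Fin 2) R) :
    MvPolynomial (Fin 2) R :=
  MvPolynomial.pderiv 0 f *
      (MvPolynomial.C 2 * MvPolynomial.X 1 + MvPolynomial.C W.a₁ * MvPolynomial.X 0 +
        MvPolynomial.C W.a₃) +
    MvPolynomial.pderiv 1 f *
      (MvPolynomial.C 3 * MvPolynomial.X 0 ^ 2 + MvPolynomial.C (2 * W.a₂) * MvPolynomial.X 0 +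
        MvPolynomial.C W.a₄ - MvPolynomial.C W.a₁ * MvPolynomial.X 1)

/-- Unfolding `invariantDerivation`. [folklore] -/
theorem invariantDerivation_def (W : WeierstrassCurve R) (f : MvPolynomial (Fin 2) R) :
    W.invariantDerivation f =
      MvPolynomial.pderiv 0 f *
          (MvPolynomial.C 2 * MvPolynomial.X 1 + MvPolynomial.C W.a₁ * MvPolynomial.X 0 +
            MvPolynomial.C W.a₃) +
        MvPolynomial.pderiv 1 f *
          (MvPolynomial.C 3 * MvPolynomial.X 0 ^ 2 + MvPolynomial.C (2 * W.a₂) * MvPolynomial.X 0 +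
            MvPolynomial.C W.a₄ - MvPolynomial.C W.a₁ * MvPolynomial.X 1) :=
  rfl

/-- The value of `δf` at a point `(x, y)`:
`(δf)(x, y) = ∂ₓf(x, y)·(2y + a₁x + a₃) + ∂_yf(x, y)·(3x² + 2a₂x + a₄ − a₁y)`. [folklore] -/
theorem eval_invariantDerivation (W : WeierstrassCurve R) (f : MvPolynomial (Fin 2) R)
    (x y : R) :
    MvPolynomial.eval ![x, y] (W.invariantDerivation f) =
      MvPolynomial.eval ![x, y] (MvPolynomial.pderiv 0 f) * (2 * y + W.a₁ * x + W.a₃) +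
        MvPolynomial.eval ![x, y] (MvPolynomial.pderiv 1 f) *
          (3 * x ^ 2 + 2 * W.a₂ * x + W.a₄ - W.a₁ * y) := by
  simp only [invariantDerivation, map_add, map_sub, map_mul, map_pow, MvPolynomial.eval_C,
    MvPolynomial.eval_X, Matrix.cons_val_zero, Matrix.cons_val_one]

/-- `δ` commutes with base change: `δ_{W ⊗ S}(f ⊗ S) = (δ_W f) ⊗ S` for a ring map `R → S`
(Mathlib `MvPolynomial.pderiv_map`). [folklore] -/
theorem invariantDerivation_map {S : Type*} [CommRing S] (W : WeierstrassCurve R) (g : R →+* S)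
    (f : MvPolynomial (Fin 2) R) :
    (W.map g).invariantDerivation (MvPolynomial.map g f) =
      MvPolynomial.map g (W.invariantDerivation f) := by
  simp only [invariantDerivation, MvPolynomial.pderiv_map, map_add, map_sub, map_mul, map_pow,
    MvPolynomial.map_C, MvPolynomial.map_X, map_a₁, map_a₂, map_a₃, map_a₄, map_ofNat]

/-- `δ` is additive. [folklore] -/
theorem invariantDerivation_add (W : WeierstrassCurve R) (f g : MvPolynomial (Fin 2) R) :
    W.invariantDerivation (f + g) = W.invariantDerivation f + W.invariantDerivation g := by
  simp only [invariantDerivation, map_add]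
  ring

/-- `δ` kills constants. [folklore] -/
theorem invariantDerivation_C (W : WeierstrassCurve R) (a : R) :
    W.invariantDerivation (MvPolynomial.C a) = 0 := by
  simp only [invariantDerivation, MvPolynomial.pderiv_C, zero_mul, add_zero]

/-- The Leibniz rule for `δ` against a variable: `δ(f·xᵢ) = δf·xᵢ + f·δxᵢ`. [folklore] -/
theorem invariantDerivation_mul_X (W : WeierstrassCurve R) (f : MvPolynomial (Fin 2) R)
    (i : Fin 2) :
    W.invariantDerivation (f * MvPolynomial.X i) =
      W.invariantDerivation f * MvPolynomial.X i + f * W.invariantDerivation (MvPolynomial.X i) := by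
  simp only [invariantDerivation, Derivation.leibniz, smul_eq_mul]
  ring

end WeierstrassCurve

/-! ### `δ` is `d/dz` along `z ↦ (℘(z), ℘'(z)/2)` -/

namespace Literature.NumberTheory.EllipticCurves

/-- **Chain rule for two-variable polynomials along a curve**: if `x, y : ℂ → ℂ` have derivatives
`x', y'` at `t`, then `t ↦ f(x(t), y(t))` has derivative `∂ₓf·x' + ∂_yf·y'` at `t` (induction on
`f`). [folklore] -/
theorem hasDerivAt_mvPolynomial_eval (f : MvPolynomial (Fin 2) ℂ) {x y : ℂ → ℂ} {x' y' t : ℂ}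
    (hx : HasDerivAt x x' t) (hy : HasDerivAt y y' t) :
    HasDerivAt (fun s ↦ MvPolynomial.eval ![x s, y s] f)
      (MvPolynomial.eval ![x t, y t] (MvPolynomial.pderiv 0 f) * x' +
        MvPolynomial.eval ![x t, y t] (MvPolynomial.pderiv 1 f) * y') t := by
  induction f using MvPolynomial.induction_on with
  | C a =>
    simp only [MvPolynomial.eval_C, MvPolynomial.pderiv_C, map_zero, zero_mul, add_zero]
    exact hasDerivAt_const t a
  | add p q hp hq =>
    have e1 : (fun s ↦ MvPolynomial.eval ![x s, y s] (p + q)) =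
        fun s ↦ MvPolynomial.eval ![x s, y s] p + MvPolynomial.eval ![x s, y s] q := by
      funext s
      rw [map_add]
    rw [e1]
    refine (hp.add hq).congr_deriv ?_
    simp only [map_add]
    ring
  | mul_X p i hp =>
    -- the `i`-th coordinate function `u ∈ {x, y}` and its derivative `u'`
    obtain ⟨u, u', hu, hux, hu'⟩ : ∃ (u : ℂ → ℂ) (u' : ℂ), HasDerivAt u u' t ∧
        (∀ s, (![x s, y s] : Fin 2 → ℂ) i = u s) ∧
        u' = (Pi.single (M := fun _ : Fin 2 ↦ ℂ) i (1 : ℂ) 0) * x' +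
          (Pi.single (M := fun _ : Fin 2 ↦ ℂ) i (1 : ℂ) 1) * y' := by
      fin_cases i
      · exact ⟨x, x', hx, fun s ↦ rfl, by simp⟩
      · exact ⟨y, y', hy, fun s ↦ rfl, by simp⟩
    have h := hp.fun_mul hu
    have e1 : (fun s ↦ MvPolynomial.eval ![x s, y s] (p * MvPolynomial.X i)) =
        fun s ↦ MvPolynomial.eval ![x s, y s] p * u s := by
      funext s
      rw [map_mul, MvPolynomial.eval_X, hux]
    rw [e1]
    refine h.congr_deriv ?_
    classical
    simp only [Derivation.leibniz, MvPolynomial.pderiv_X, smul_eq_mul, map_add, map_mul,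
      MvPolynomial.eval_X, hux, hu']
    have hP : ∀ j : Fin 2, MvPolynomial.eval ![x t, y t]
        (Pi.single (M := fun _ : Fin 2 ↦ MvPolynomial (Fin 2) ℂ) j 1 i) =
        Pi.single (M := fun _ : Fin 2 ↦ ℂ) i (1 : ℂ) j := by
      intro j
      by_cases hij : i = j
      · subst hij; simp
      · simp [Pi.single_eq_of_ne hij, Pi.single_eq_of_ne (Ne.symm hij)]
    rw [hP 0, hP 1]
    ring

end Literature.NumberTheory.EllipticCurves

namespace PeriodPair

open Literature.NumberTheory.EllipticCurves

variable (L : PeriodPair)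

/-- **`δ` is `d/dz` on `E_Λ`**: for `z ∉ Λ`,
`d/dz f(℘(z), ℘'(z)/2) = (δ_{E_Λ} f)(℘(z), ℘'(z)/2)`, because `℘' = 2·(℘'/2)` and
`(℘'/2)' = ℘''/2 = 3℘² − g₂/4 = 3x² + a₄(E_Λ)` (the tree's `hasDerivAt_derivWeierstrassP`,
`℘'' = 6℘² − g₂/2`). [folklore] -/
theorem hasDerivAt_eval_weierstrassP (f : MvPolynomial (Fin 2) ℂ) {z : ℂ} (hz : z ∉ L.lattice) :
    HasDerivAt (fun s ↦ MvPolynomial.eval ![℘[L] s, ℘'[L] s / 2] f)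
      (MvPolynomial.eval ![℘[L] z, ℘'[L] z / 2] (L.curve.invariantDerivation f)) z := by
  have hx : HasDerivAt ℘[L] (℘'[L] z) z := L.hasDerivAt_weierstrassP hz
  have hy : HasDerivAt (fun s ↦ ℘'[L] s / 2) ((6 * ℘[L] z ^ 2 - L.g₂ / 2) / 2) z :=
    (L.hasDerivAt_derivWeierstrassP hz).div_const 2
  have h := hasDerivAt_mvPolynomial_eval f hx hy
  rw [WeierstrassCurve.eval_invariantDerivation]
  simp only [curve_a₁, curve_a₂, curve_a₃, curve_a₄]
  convert h using 1
  ring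

/-! ### A local affine transformation `℘_{Λ₂}(c' + αζ) = N(ζ)/D(ζ)` with `Λ₁`-periodic `N, D` forces `αΛ₁ ⊆ Λ₂` -/

variable {L}

/-- **`αΛ₁ ⊆ Λ₂` from a local affine transformation between `℘_{Λ₁}`-periodic data and
`℘_{Λ₂}`** (two-lattice form of the tree's `mul_mem_lattice_of_weierstrassP_affine_eq`).  Let
`N, D` be `Λ₁`-periodic functions analytic off `Λ₁`, and suppose that near some `z₀ ∉ Λ₁` with
`D(z₀) ≠ 0` and `c' + αz₀ ∉ Λ₂` one has `N(ζ) = ℘_{Λ₂}(c' + αζ)·D(ζ)`, `α ≠ 0`.  Then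
`αΛ₁ ⊆ Λ₂`: the identity persists on the connected co-countable open set where both sides are
analytic; `Λ₁`-periodicity of `N/D` gives `℘_{Λ₂}(αl + w) = ℘_{Λ₂}(w)` near a point for
`l ∈ Λ₁`, and a local translation symmetry of `℘_{Λ₂}` is a period
(`mem_lattice_of_weierstrassP_add_eventuallyEq`).  This is the step "`f(z + ω) − f(z) ∈ Λ₂` …
`αΛ₁ ⊂ Λ₂`" of Silverman's proof of *AEC* VI.4.1(a), run on the curve side.
[cite: SilvermanAEC2009, Thm. VI.4.1 (proof, PDF p. 153)] -/
theorem mul_mem_lattice_of_weierstrassP_affine_eq₂ {L₁ L₂ : PeriodPair} {α c' z₀ : ℂ} (hα : α ≠ 0)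
    {N D : ℂ → ℂ} (hN : AnalyticOnNhd ℂ N (L₁.lattice : Set ℂ)ᶜ)
    (hD : AnalyticOnNhd ℂ D (L₁.lattice : Set ℂ)ᶜ)
    (hNper : ∀ z : ℂ, ∀ l ∈ L₁.lattice, N (z + l) = N z)
    (hDper : ∀ z : ℂ, ∀ l ∈ L₁.lattice, D (z + l) = D z)
    (hz₀ : z₀ ∉ L₁.lattice) (hc : c' + α * z₀ ∉ L₂.lattice) (hDz₀ : D z₀ ≠ 0)
    (h : ∀ᶠ ζ in 𝓝 z₀, N ζ = ℘[L₂] (c' + α * ζ) * D ζ) {l : ℂ} (hl : l ∈ L₁.lattice) :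
    α * l ∈ L₂.lattice := by
  have hopen₁ : IsOpen ((L₁.lattice : Set ℂ)ᶜ) := L₁.isClosed_lattice.isOpen_compl
  have hopen₂ : IsOpen ((L₂.lattice : Set ℂ)ᶜ) := L₂.isClosed_lattice.isOpen_compl
  -- `N ζ = ℘₂(c' + α ζ) D ζ` on `V = {ζ ∉ Λ₁, c' + αζ ∉ Λ₂}`
  set G : ℂ → ℂ := fun ζ ↦ N ζ - ℘[L₂] (c' + α * ζ) * D ζ with hG
  set V : Set ℂ := {ζ | ζ ∉ L₁.lattice ∧ c' + α * ζ ∉ L₂.lattice} with hV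
  have hVeq : V = ((L₁.lattice : Set ℂ) ∪
      (fun m : ℂ ↦ (m - c') / α) '' (L₂.lattice : Set ℂ))ᶜ := by
    ext ζ
    simp only [hV, mem_setOf_eq, mem_compl_iff, mem_union, mem_image, SetLike.mem_coe, not_or,
      not_exists, not_and]
    constructor
    · rintro ⟨h1, h2⟩
      refine ⟨h1, fun m hm h ↦ h2 ?_⟩
      have e : c' + α * ((m - c') / α) = m := by field_simp; ring
      rw [← h, e]
      exact hm
    · rintro ⟨h1, h2⟩
      refine ⟨h1, fun h ↦ h2 _ h ?_⟩
      field_simp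
      ring
  have hVopen : IsOpen V :=
    (hopen₁.preimage continuous_id).inter (hopen₂.preimage (by fun_prop))
  have hVcount : Vᶜ.Countable := by
    rw [hVeq, compl_compl]
    exact L₁.countable_lattice.union (L₂.countable_lattice.image _)
  have hVpre : IsPreconnected V := by
    rw [hVeq]
    exact (Set.Countable.isConnected_compl_of_one_lt_rank (by simp)
      (L₁.countable_lattice.union (L₂.countable_lattice.image _))).isPreconnected
  have hGan : AnalyticOnNhd ℂ G V := by
    intro ζ hζ
    have hi : AnalyticAt ℂ (fun ζ : ℂ ↦ c' + α * ζ) ζ := by fun_prop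
    have h℘2 : AnalyticAt ℂ (fun ζ : ℂ ↦ ℘[L₂] (c' + α * ζ)) ζ :=
      (L₂.analyticOnNhd_weierstrassP (c' + α * ζ) hζ.2).comp (f := fun ζ : ℂ ↦ c' + α * ζ) hi
    exact (hN ζ hζ.1).sub (h℘2.mul (hD ζ hζ.1))
  have hz₀V : z₀ ∈ V := ⟨hz₀, hc⟩
  have hGfreq : ∃ᶠ ζ in 𝓝[≠] z₀, G ζ = (fun _ ↦ (0 : ℂ)) ζ := by
    have h' : ∀ᶠ ζ in 𝓝[≠] z₀, G ζ = 0 := by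
      filter_upwards [mem_nhdsWithin_of_mem_nhds h] with ζ hζ
      simp only [hG, hζ, sub_self]
    exact h'.frequently
  have hGV : EqOn G (fun _ ↦ (0 : ℂ)) V :=
    hGan.eqOn_of_preconnected_of_frequently_eq analyticOnNhd_const hVpre hz₀V hGfreq
  -- periodicity gives `℘₂(α l + w) = ℘₂(w)` near a point
  set O : Set ℂ := {ζ | ζ ∉ L₁.lattice ∧ D ζ ≠ 0} with hO
  have hOopen : IsOpen O := by
    rw [isOpen_iff_mem_nhds]
    rintro ζ ⟨hζ, hζD⟩
    have h2 : ∀ᶠ ξ in 𝓝 ζ, D ξ ≠ 0 := (hD ζ hζ).continuousAt.eventually_ne hζD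
    filter_upwards [hopen₁.mem_nhds hζ, h2] with ξ h1 h2 using ⟨h1, h2⟩
  set W : Set ℂ := V ∩ (fun ζ ↦ ζ + l) ⁻¹' V with hW
  have hWopen : IsOpen W := hVopen.inter (hVopen.preimage (by fun_prop))
  have hWdense : Dense W := by
    have hcount : Wᶜ.Countable := by
      rw [hW, compl_inter]
      refine hVcount.union ?_
      have : ((fun ζ : ℂ ↦ ζ + l) ⁻¹' V)ᶜ = (fun ζ : ℂ ↦ ζ - l) '' Vᶜ := by
        ext ζ
        simp only [mem_compl_iff, mem_preimage, mem_image]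
        constructor
        · intro h
          exact ⟨ζ + l, h, by ring⟩
        · rintro ⟨ξ, hξ, rfl⟩
          simpa using hξ
      rw [this]
      exact hVcount.image _
    simpa using hcount.dense_compl ℝ
  obtain ⟨ζ₁, hζ₁O, hζ₁W⟩ : (O ∩ W).Nonempty :=
    hWdense.inter_open_nonempty O hOopen ⟨z₀, hz₀, hDz₀⟩
  have hper : ∀ᶠ w in 𝓝 (c' + α * ζ₁), ℘[L₂] (α * l + w) = ℘[L₂] w := by
    have hOW : O ∩ W ∈ 𝓝 ζ₁ := (hOopen.inter hWopen).mem_nhds ⟨hζ₁O, hζ₁W⟩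
    have hcont : ContinuousAt (fun w : ℂ ↦ (w - c') / α) (c' + α * ζ₁) := by fun_prop
    have e0 : (c' + α * ζ₁ - c') / α = ζ₁ := by
      rw [add_sub_cancel_left, mul_div_cancel_left₀ _ hα]
    have hpre := hcont.preimage_mem_nhds (by rw [e0]; exact hOW)
    filter_upwards [hpre] with w hw
    obtain ⟨ζ, rfl⟩ : ∃ ζ, w = c' + α * ζ := ⟨(w - c') / α, by rw [mul_div_cancel₀ _ hα]; ring⟩
    have e0' : (c' + α * ζ - c') / α = ζ := by
      rw [add_sub_cancel_left, mul_div_cancel_left₀ _ hα]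
    have hw' : ζ ∈ O ∩ W := by simpa only [mem_preimage, e0'] using hw
    obtain ⟨⟨-, hDζ⟩, hζV, hζV'⟩ := hw'
    have hNl : N (ζ + l) = N ζ := hNper ζ l hl
    have hDl : D (ζ + l) = D ζ := hDper ζ l hl
    have e1 := hGV hζV
    have e2 := hGV hζV'
    simp only [hG, hNl, hDl, sub_eq_zero] at e1 e2
    rw [show α * l + (c' + α * ζ) = c' + α * (ζ + l) by ring]
    exact mul_right_cancel₀ hDζ (e2.symm.trans e1)
  -- a local translation symmetry of `℘₂` is a period of `Λ₂`
  refine L₂.mem_lattice_of_weierstrassP_add_eventuallyEq hζ₁W.1.2 ?_ hper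
  have := hζ₁W.2.2
  rwa [show c' + α * (ζ₁ + l) = α * l + (c' + α * ζ₁) by ring] at this


/-! ### The analytic core: an additive map rational in `(℘_{Λ₁}, ℘'_{Λ₁}/2) ↦ (℘_{Λ₂}, ℘'_{Λ₂}/2)` is `z ↦ αz` -/

/-- **An additive map `G → ℂ/Λ₂`, rational through `(℘, ℘'/2)`, is multiplication by a complex
number `α` with `αΛ₁ ⊆ Λ₂`** (Silverman, *AEC*, Thm. VI.4.1, in the local form of the tree).  Let
`G ≤ ℂ` contain all division points of `Λ₁`, and let `Ψ : G → ℂ` be additive modulo `Λ₂` and, off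
finitely many cosets `T + Λ₁`, be given through `℘_{Λ₂}` by rational functions of
`(℘_{Λ₁}(z), ℘'_{Λ₁}(z)/2)`.  Then there is `α ∈ ℂ` with `αΛ₁ ⊆ Λ₂` and `Ψ(z) ≡ αz (mod Λ₂)` for
**all** `z ∈ G`: a local holomorphic lift near a generic division point `a` exists
(`exists_local_lift`) and is affine, `z ↦ αz + β`, by additivity (`exists_eq_affine_of_lifts`);
`℘_{Λ₂}(αz + β) = (p₁/q₁)(℘_{Λ₁} z, ℘'_{Λ₁} z/2)` near `a` forces `αΛ₁ ⊆ Λ₂`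
(`mul_mem_lattice_of_weierstrassP_affine_eq₂`); and `Ψ(g) ≡ αg` first for small `g ∈ G`
(additivity at `a`), then for all `g ∈ G`, every element of `G` being a small element plus a
multiple of a small division point. [cite: SilvermanAEC2009, Thm. VI.4.1 (PDF pp. 152–153)] -/
theorem exists_mul_of_rational_lift₂ (L₁ L₂ : PeriodPair) (G : AddSubgroup ℂ)
    (hdiv : ∀ n : ℕ, 0 < n → ∀ l ∈ L₁.lattice, l / n ∈ G)
    (Ψ : ℂ → ℂ) (hadd : ∀ z ∈ G, ∀ w ∈ G, Ψ (z + w) - Ψ z - Ψ w ∈ L₂.lattice)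
    (p₁ q₁ p₂ q₂ : MvPolynomial (Fin 2) ℂ) (T : Finset ℂ)
    (hrat : ∀ z ∈ G, (∀ t ∈ T, z - t ∉ L₁.lattice) →
      z ∉ L₁.lattice ∧ Ψ z ∉ L₂.lattice ∧ ℘'[L₂] (Ψ z) ≠ 0 ∧
      MvPolynomial.eval ![℘[L₁] z, ℘'[L₁] z / 2] q₁ ≠ 0 ∧
      MvPolynomial.eval ![℘[L₁] z, ℘'[L₁] z / 2] q₂ ≠ 0 ∧
      ℘[L₂] (Ψ z) = MvPolynomial.eval ![℘[L₁] z, ℘'[L₁] z / 2] p₁ /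
        MvPolynomial.eval ![℘[L₁] z, ℘'[L₁] z / 2] q₁ ∧
      ℘'[L₂] (Ψ z) / 2 = MvPolynomial.eval ![℘[L₁] z, ℘'[L₁] z / 2] p₂ /
        MvPolynomial.eval ![℘[L₁] z, ℘'[L₁] z / 2] q₂) :
    ∃ α : ℂ, (∀ l ∈ L₁.lattice, α * l ∈ L₂.lattice) ∧ ∀ z ∈ G, Ψ z - α * z ∈ L₂.lattice := by
  have hopen₁ : IsOpen ((L₁.lattice : Set ℂ)ᶜ) := L₁.isClosed_lattice.isOpen_compl
  -- the coordinate functions `(℘₁, ℘₁'/2)` and the four functions `p_i(℘₁, ℘₁'/2)`, `q_i(…)`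
  set v : ℂ → Fin 2 → ℂ := fun z ↦ ![℘[L₁] z, ℘'[L₁] z / 2] with hv
  have hvan : ∀ z ∉ L₁.lattice, ∀ i, AnalyticAt ℂ (fun z ↦ v z i) z := by
    intro z hz i
    fin_cases i
    · simpa [hv] using L₁.analyticOnNhd_weierstrassP z hz
    · have h2 : AnalyticAt ℂ (fun x ↦ ℘'[L₁] x / 2) z :=
        (L₁.analyticOnNhd_derivWeierstrassP z hz).div_const
      simpa [hv] using h2
  have han : ∀ p : MvPolynomial (Fin 2) ℂ,
      AnalyticOnNhd ℂ (fun z ↦ MvPolynomial.eval (v z) p) (L₁.lattice : Set ℂ)ᶜ := by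
    intro p z hz
    have := AnalyticAt.aeval_mvPolynomial (hvan z hz) p
    simpa only [MvPolynomial.aeval_eq_eval] using this
  have hper : ∀ p : MvPolynomial (Fin 2) ℂ, ∀ z : ℂ, ∀ l ∈ L₁.lattice,
      MvPolynomial.eval (v (z + l)) p = MvPolynomial.eval (v z) p := by
    intro p z l hl
    have h1 : ℘[L₁] (z + l) = ℘[L₁] z := by simpa using L₁.weierstrassP_add_coe z ⟨l, hl⟩
    have h2 : ℘'[L₁] (z + l) = ℘'[L₁] z := by simpa using L₁.derivWeierstrassP_add_coe z ⟨l, hl⟩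
    simp only [hv, h1, h2]
  set N₁ : ℂ → ℂ := fun z ↦ MvPolynomial.eval (v z) p₁ with hN₁
  set D₁ : ℂ → ℂ := fun z ↦ MvPolynomial.eval (v z) q₁ with hD₁
  set N₂ : ℂ → ℂ := fun z ↦ MvPolynomial.eval (v z) p₂ with hN₂
  set D₂ : ℂ → ℂ := fun z ↦ MvPolynomial.eval (v z) q₂ with hD₂
  -- the bad cosets and the open set `U`
  set Bset : Set ℂ := {z | ∃ t ∈ T, z - t ∈ L₁.lattice} with hBset
  have hBclosed : IsClosed Bset := by
    have : Bset = ⋃ t ∈ (T : Set ℂ), (fun z ↦ z - t) ⁻¹' (L₁.lattice : Set ℂ) := by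
      ext z; simp [hBset]
    rw [this]
    exact T.finite_toSet.isClosed_biUnion fun t _ ↦ L₁.isClosed_lattice.preimage (by fun_prop)
  have hgood : ∀ z, z ∉ Bset → ∀ t ∈ T, z - t ∉ L₁.lattice :=
    fun z hz t ht hmem ↦ hz ⟨t, ht, hmem⟩
  set U : Set ℂ := {z | z ∉ L₁.lattice ∧ D₁ z ≠ 0 ∧ D₂ z ≠ 0 ∧ z ∉ Bset} with hU
  have hUopen : IsOpen U := by
    rw [isOpen_iff_mem_nhds]
    rintro z ⟨hz, hz₁, hz₂, hzB⟩
    have e1 : ∀ᶠ w in 𝓝 z, D₁ w ≠ 0 := (han q₁ z hz).continuousAt.eventually_ne hz₁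
    have e2 : ∀ᶠ w in 𝓝 z, D₂ w ≠ 0 := (han q₂ z hz).continuousAt.eventually_ne hz₂
    filter_upwards [hopen₁.mem_nhds hz, e1, e2, hBclosed.isOpen_compl.mem_nhds hzB]
      with w h0 h1 h2 h3 using ⟨h0, h1, h2, h3⟩
  set R : ℂ → ℂ := fun z ↦ N₁ z / D₁ z with hR
  set K : ℂ → ℂ := fun z ↦ N₂ z / D₂ z with hK
  have hRd : DifferentiableOn ℂ R U := fun z hz ↦
    (((han p₁ z hz.1).differentiableAt).div (han q₁ z hz.1).differentiableAt
      hz.2.1).differentiableWithinAt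
  have hKc : ContinuousOn K U := fun z hz ↦
    (((han p₂ z hz.1).continuousAt).div (han q₂ z hz.1).continuousAt hz.2.2.1).continuousWithinAt
  have hΨU : ∀ z ∈ U, z ∈ (G : Set ℂ) →
      Ψ z ∉ L₂.lattice ∧ ℘[L₂] (Ψ z) = R z ∧ ℘'[L₂] (Ψ z) / 2 = K z := by
    intro z hz hzG
    obtain ⟨-, h1, -, -, -, h2, h3⟩ := hrat z hzG (hgood z hz.2.2.2)
    exact ⟨h1, h2, h3⟩
  -- Step 1: a generic division point `a` of `Λ₁`
  obtain ⟨n, hn, hgood₁, hgood₂⟩ := L₁.exists_generic_div_point T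
  set a : ℂ := L₁.ω₁ / n with hadef
  have haG : a ∈ G := hdiv n hn _ L₁.ω₁_mem_lattice
  have haB : a ∉ Bset := fun ⟨t, ht, h⟩ ↦ hgood₁ t ht h
  have haaB : a + a ∉ Bset := fun ⟨t, ht, h⟩ ↦ hgood₂ t ht h
  obtain ⟨ha1, -, ha3, ha4, ha5, -, -⟩ := hrat a haG (hgood a haB)
  obtain ⟨haa1, -, haa3, haa4, haa5, -, -⟩ := hrat (a + a) (G.add_mem haG haG) (hgood _ haaB)
  have haU : a ∈ U := ⟨ha1, ha4, ha5, haB⟩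
  have haaU : a + a ∈ U := ⟨haa1, haa4, haa5, haaB⟩
  -- Step 2: local holomorphic lifts near `a` and `2a` (through `℘_{Λ₂}`)
  obtain ⟨ε₁, hε₁, F₁, hsub₁, hF₁d, hF₁℘, hF₁Ψ⟩ :=
    L₂.exists_local_lift hUopen haU haG hRd hKc hΨU ha3
  obtain ⟨ε₂, hε₂, F₂, -, hF₂d, -, hF₂Ψ⟩ :=
    L₂.exists_local_lift hUopen haaU (G.add_mem haG haG) hRd hKc hΨU haa3
  -- Step 3: the lift near `a` is affine
  have hdense : Dense (G : Set ℂ) := dense_of_div_mem hdiv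
  obtain ⟨α, β, ε, hε, hεle, haff⟩ :=
    L₂.exists_eq_affine_of_lifts hdense hadd haG hε₁ hε₂ hF₁d hF₂d hF₁Ψ hF₂Ψ
  -- Step 4: `Ψ ≡ α·` on all of `G`
  have hsmall : ∀ g ∈ G, ‖g‖ < ε → Ψ g - α * g ∈ L₂.lattice := by
    intro g hg hgε
    have hag : a + g ∈ Metric.ball a ε := by
      simpa [Metric.mem_ball, dist_eq_norm] using hgε
    have h1 := hF₁Ψ (a + g) (Metric.ball_subset_ball hεle hag) (G.add_mem haG hg)
    have h2 := hF₁Ψ a (Metric.mem_ball_self hε₁) haG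
    have h3 := hadd a haG g hg
    have e : Ψ g - α * g =
        -(Ψ (a + g) - Ψ a - Ψ g) - (F₁ (a + g) - Ψ (a + g)) + (F₁ a - Ψ a) := by
      rw [haff (a + g) hag, haff a (Metric.mem_ball_self hε)]
      ring
    rw [e]
    exact add_mem (sub_mem (neg_mem h3) h1) h2
  have hlin : ∀ z ∈ G, Ψ z - α * z ∈ L₂.lattice := by
    intro z hzG
    -- a general element of `G` is a small element plus a multiple of a small division point
    obtain ⟨N, l, hN, hl, hzl⟩ := L₁.exists_norm_sub_div_lt z hε
    obtain ⟨m', hm'⟩ := exists_nat_gt (‖l / N‖ / ε)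
    have hm'pos : (0 : ℝ) < m' := lt_of_le_of_lt (by positivity) hm'
    have hm'0 : 0 < m' := by exact_mod_cast hm'pos
    have hN0 : (N : ℂ) ≠ 0 := by exact_mod_cast hN.ne'
    have hm'c : (m' : ℂ) ≠ 0 := by exact_mod_cast hm'0.ne'
    set g₂ : ℂ := l / ((N * m' : ℕ) : ℂ) with hg₂
    have hg₂G : g₂ ∈ G := hdiv (N * m') (Nat.mul_pos hN hm'0) l hl
    have hmg₂ : (m' : ℂ) * g₂ = l / N := by
      rw [hg₂, Nat.cast_mul]; field_simp
    set g₁ : ℂ := z - m' * g₂ with hg₁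
    have hg₁G : g₁ ∈ G := G.sub_mem hzG (by rw [hmg₂]; exact hdiv N hN l hl)
    have hg₁ε : ‖g₁‖ < ε := by rwa [hg₁, hmg₂]
    have hg₂ε : ‖g₂‖ < ε := by
      have e : g₂ = (l / N) / m' := by rw [← hmg₂]; field_simp
      rw [e, norm_div, Complex.norm_natCast, div_lt_iff₀ hm'pos]
      rwa [div_lt_iff₀ hε, mul_comm] at hm'
    have h1 := hsmall g₁ hg₁G hg₁ε
    have h2 := hsmall g₂ hg₂G hg₂ε
    have h3 := sub_nsmul_mem_of_add hadd hg₂G m'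
    have h4 := hadd g₁ hg₁G (m' * g₂) (by simpa using G.nsmul_mem hg₂G m')
    have e : Ψ z - α * z = (Ψ (g₁ + m' * g₂) - Ψ g₁ - Ψ (m' * g₂)) + (Ψ g₁ - α * g₁) +
        (Ψ (m' * g₂) - m' * Ψ g₂) + m' * (Ψ g₂ - α * g₂) := by
      rw [hg₁]; ring_nf
    rw [e]
    refine add_mem (add_mem (add_mem h4 h1) h3) ?_
    simpa [nsmul_eq_mul] using nsmul_mem h2 m'
  refine ⟨α, fun l hl ↦ ?_, hlin⟩
  -- Step 5: `℘₂(β + αζ) = N₁/D₁` near `a` forces `αΛ₁ ⊆ Λ₂`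
  by_cases hα0 : α = 0
  · rw [hα0, zero_mul]; exact zero_mem _
  refine mul_mem_lattice_of_weierstrassP_affine_eq₂ (c' := β) (z₀ := a) hα0 (han p₁) (han q₁)
    (hper p₁) (hper q₁) ha1 ?_ ha4 ?_ hl
  · have := (hF₁℘ a (Metric.mem_ball_self hε₁)).1
    rwa [haff a (Metric.mem_ball_self hε), show α * a + β = β + α * a by ring] at this
  · filter_upwards [Metric.isOpen_ball.mem_nhds (Metric.mem_ball_self hε)] with ζ hζ
    have hζ₁ : ζ ∈ Metric.ball a ε₁ := Metric.ball_subset_ball hεle hζ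
    obtain ⟨-, h℘F⟩ := hF₁℘ ζ hζ₁
    have hD₁ζ : D₁ ζ ≠ 0 := (hsub₁ hζ₁).2.1
    rw [haff ζ hζ, show α * ζ + β = β + α * ζ by ring] at h℘F
    rw [h℘F, hR]
    exact (div_mul_cancel₀ _ hD₁ζ).symm


/-! ### The multiplier computed algebraically: `α · 2p₂q₁² = (δp₁·q₁ − p₁·δq₁)·q₂` -/

/-- A continuous function on a ball which is `Λ`-valued on a dense subset is constant there
(`Λ` is closed and discrete, the ball is connected). [folklore] -/
lemma exists_eq_const_of_sub_mem_lattice (L : PeriodPair) {G : Set ℂ} (hdense : Dense G)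
    {a : ℂ} {ε : ℝ} {H : ℂ → ℂ} (hH : ContinuousOn H (Metric.ball a ε))
    (hmem : ∀ z ∈ Metric.ball a ε, z ∈ G → H z ∈ L.lattice) :
    ∃ β : ℂ, ∀ z ∈ Metric.ball a ε, H z = β := by
  set B : Set ℂ := Metric.ball a ε with hB
  have hmaps : MapsTo H B (L.lattice : Set ℂ) := by
    intro z hz
    have hsub : B ⊆ closure (B ∩ G) := hdense.open_subset_closure_inter Metric.isOpen_ball
    have hcw : ContinuousWithinAt H (B ∩ G) z := (hH.continuousWithinAt hz).mono inter_subset_left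
    have hcl := hcw.mem_closure_image (hsub hz)
    have himg : H '' (B ∩ G) ⊆ L.lattice := by
      rintro _ ⟨w, ⟨hw, hwG⟩, rfl⟩
      exact hmem w hw hwG
    exact L.isClosed_lattice.closure_subset_iff.2 himg hcl
  have hdisc : IsDiscrete (L.lattice : Set ℂ) :=
    SetLike.isDiscrete_iff_discreteTopology.2 inferInstance
  by_cases hne : B.Nonempty
  · obtain ⟨z₀, hz₀⟩ := hne
    exact ⟨H z₀, fun z hz ↦
      (convex_ball a ε).isPreconnected.constant_of_mapsTo hdisc hH hmaps hz hz₀⟩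
  · exact ⟨0, fun z hz ↦ (hne ⟨z, hz⟩).elim⟩

/-- **The multiplier of a rational map, algebraically.**  Let `G ≤ ℂ` contain the division
points of `Λ₁` and let `Ψ : G → ℂ` satisfy `Ψ(z) ≡ αz (mod Λ₂)` on `G` and be given, off
finitely many cosets `T + Λ₁`, through `℘_{Λ₂}` by rational functions of
`(x, y) = (℘_{Λ₁}(z), ℘'_{Λ₁}(z)/2)`: `℘_{Λ₂}(Ψ z) = (p₁/q₁)(x, y)`,
`℘'_{Λ₂}(Ψ z)/2 = (p₂/q₂)(x, y)`.  Then for **every** `z ∉ Λ₁`,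
`α · (2p₂q₁²)(x, y) = ((δp₁·q₁ − p₁·δq₁)·q₂)(x, y)` with `δ = δ_{E_{Λ₁}}` the invariant
derivation (`WeierstrassCurve.invariantDerivation`, here `d/dz`): near a generic division point a
local holomorphic lift `F` of `Ψ` (`exists_local_lift`) is `αz + β` (it differs from `αz` by a
continuous `Λ₂`-valued function), so differentiating `℘_{Λ₂}(F z) = (p₁/q₁)(x, y)` gives
`α ℘'_{Λ₂}(F z) = d/dz (p₁/q₁)(x, y)` while `℘'_{Λ₂}(F z) = 2(p₂/q₂)(x, y)`; the resulting
identity of `Λ₁`-elliptic functions extends from the neighbourhood to `ℂ ∖ Λ₁` by the identity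
theorem.  In terms of differentials this is `ψ^*(dx'/2y') = α·(dx/2y)` for the map
`ψ = (p₁/q₁, p₂/q₂) : E_{Λ₁} → E_{Λ₂}` (Silverman, *AEC*, III.5; VI.5.2: `dx/y` pulls back to
`dz`). [cite: SilvermanAEC2009, Thm. VI.4.1 and III.5 (PDF pp. 75, 152–153)] -/
theorem mul_eval_eq_of_rational_of_linear (L₁ L₂ : PeriodPair) (G : AddSubgroup ℂ)
    (hdiv : ∀ n : ℕ, 0 < n → ∀ l ∈ L₁.lattice, l / n ∈ G)
    (Ψ : ℂ → ℂ) {α : ℂ} (hlin : ∀ z ∈ G, Ψ z - α * z ∈ L₂.lattice)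
    (p₁ q₁ p₂ q₂ : MvPolynomial (Fin 2) ℂ) (T : Finset ℂ)
    (hrat : ∀ z ∈ G, (∀ t ∈ T, z - t ∉ L₁.lattice) →
      z ∉ L₁.lattice ∧ Ψ z ∉ L₂.lattice ∧ ℘'[L₂] (Ψ z) ≠ 0 ∧
      MvPolynomial.eval ![℘[L₁] z, ℘'[L₁] z / 2] q₁ ≠ 0 ∧
      MvPolynomial.eval ![℘[L₁] z, ℘'[L₁] z / 2] q₂ ≠ 0 ∧
      ℘[L₂] (Ψ z) = MvPolynomial.eval ![℘[L₁] z, ℘'[L₁] z / 2] p₁ /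
        MvPolynomial.eval ![℘[L₁] z, ℘'[L₁] z / 2] q₁ ∧
      ℘'[L₂] (Ψ z) / 2 = MvPolynomial.eval ![℘[L₁] z, ℘'[L₁] z / 2] p₂ /
        MvPolynomial.eval ![℘[L₁] z, ℘'[L₁] z / 2] q₂) {z : ℂ} (hz : z ∉ L₁.lattice) :
    α * MvPolynomial.eval ![℘[L₁] z, ℘'[L₁] z / 2] (MvPolynomial.C 2 * p₂ * q₁ ^ 2) =
      MvPolynomial.eval ![℘[L₁] z, ℘'[L₁] z / 2]
        ((L₁.curve.invariantDerivation p₁ * q₁ - p₁ * L₁.curve.invariantDerivation q₁) * q₂) := by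
  have hopen₁ : IsOpen ((L₁.lattice : Set ℂ)ᶜ) := L₁.isClosed_lattice.isOpen_compl
  have hopen₂ : IsOpen ((L₂.lattice : Set ℂ)ᶜ) := L₂.isClosed_lattice.isOpen_compl
  -- the coordinate functions and the four functions `p_i(℘₁, ℘₁'/2)`, `q_i(…)`
  set v : ℂ → Fin 2 → ℂ := fun z ↦ ![℘[L₁] z, ℘'[L₁] z / 2] with hv
  have hvan : ∀ z ∉ L₁.lattice, ∀ i, AnalyticAt ℂ (fun z ↦ v z i) z := by
    intro z hz i
    fin_cases i
    · simpa [hv] using L₁.analyticOnNhd_weierstrassP z hz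
    · have h2 : AnalyticAt ℂ (fun x ↦ ℘'[L₁] x / 2) z :=
        (L₁.analyticOnNhd_derivWeierstrassP z hz).div_const
      simpa [hv] using h2
  have han : ∀ p : MvPolynomial (Fin 2) ℂ,
      AnalyticOnNhd ℂ (fun z ↦ MvPolynomial.eval (v z) p) (L₁.lattice : Set ℂ)ᶜ := by
    intro p z hz
    have := AnalyticAt.aeval_mvPolynomial (hvan z hz) p
    simpa only [MvPolynomial.aeval_eq_eval] using this
  set N₁ : ℂ → ℂ := fun z ↦ MvPolynomial.eval (v z) p₁ with hN₁
  set D₁ : ℂ → ℂ := fun z ↦ MvPolynomial.eval (v z) q₁ with hD₁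
  set N₂ : ℂ → ℂ := fun z ↦ MvPolynomial.eval (v z) p₂ with hN₂
  set D₂ : ℂ → ℂ := fun z ↦ MvPolynomial.eval (v z) q₂ with hD₂
  -- the bad cosets and the open set `U`
  set Bset : Set ℂ := {z | ∃ t ∈ T, z - t ∈ L₁.lattice} with hBset
  have hBclosed : IsClosed Bset := by
    have : Bset = ⋃ t ∈ (T : Set ℂ), (fun z ↦ z - t) ⁻¹' (L₁.lattice : Set ℂ) := by
      ext z; simp [hBset]
    rw [this]
    exact T.finite_toSet.isClosed_biUnion fun t _ ↦ L₁.isClosed_lattice.preimage (by fun_prop)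
  have hgood : ∀ z, z ∉ Bset → ∀ t ∈ T, z - t ∉ L₁.lattice :=
    fun z hz t ht hmem ↦ hz ⟨t, ht, hmem⟩
  set U : Set ℂ := {z | z ∉ L₁.lattice ∧ D₁ z ≠ 0 ∧ D₂ z ≠ 0 ∧ z ∉ Bset} with hU
  have hUopen : IsOpen U := by
    rw [isOpen_iff_mem_nhds]
    rintro z ⟨hz, hz₁, hz₂, hzB⟩
    have e1 : ∀ᶠ w in 𝓝 z, D₁ w ≠ 0 := (han q₁ z hz).continuousAt.eventually_ne hz₁
    have e2 : ∀ᶠ w in 𝓝 z, D₂ w ≠ 0 := (han q₂ z hz).continuousAt.eventually_ne hz₂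
    filter_upwards [hopen₁.mem_nhds hz, e1, e2, hBclosed.isOpen_compl.mem_nhds hzB]
      with w h0 h1 h2 h3 using ⟨h0, h1, h2, h3⟩
  set R : ℂ → ℂ := fun z ↦ N₁ z / D₁ z with hR
  set K : ℂ → ℂ := fun z ↦ N₂ z / D₂ z with hK
  have hRd : DifferentiableOn ℂ R U := fun z hz ↦
    (((han p₁ z hz.1).differentiableAt).div (han q₁ z hz.1).differentiableAt
      hz.2.1).differentiableWithinAt
  have hKc : ContinuousOn K U := fun z hz ↦
    (((han p₂ z hz.1).continuousAt).div (han q₂ z hz.1).continuousAt hz.2.2.1).continuousWithinAt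
  have hΨU : ∀ z ∈ U, z ∈ (G : Set ℂ) →
      Ψ z ∉ L₂.lattice ∧ ℘[L₂] (Ψ z) = R z ∧ ℘'[L₂] (Ψ z) / 2 = K z := by
    intro z hz hzG
    obtain ⟨-, h1, -, -, -, h2, h3⟩ := hrat z hzG (hgood z hz.2.2.2)
    exact ⟨h1, h2, h3⟩
  -- a generic division point `a` of `Λ₁` and a local holomorphic lift near it
  obtain ⟨n, hn, hgood₁, -⟩ := L₁.exists_generic_div_point T
  set a : ℂ := L₁.ω₁ / n with hadef
  have haG : a ∈ G := hdiv n hn _ L₁.ω₁_mem_lattice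
  have haB : a ∉ Bset := fun ⟨t, ht, h⟩ ↦ hgood₁ t ht h
  obtain ⟨ha1, -, ha3, ha4, ha5, -, -⟩ := hrat a haG (hgood a haB)
  have haU : a ∈ U := ⟨ha1, ha4, ha5, haB⟩
  obtain ⟨ε, hε, F, hsub, hFd, hF℘, hFΨ⟩ :=
    L₂.exists_local_lift hUopen haU haG hRd hKc hΨU ha3
  -- the lift is `αz + β`
  have hdense : Dense (G : Set ℂ) := dense_of_div_mem hdiv
  obtain ⟨β, hβ⟩ := L₂.exists_eq_const_of_sub_mem_lattice hdense (H := fun z ↦ F z - α * z)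
    (hFd.continuousOn.sub (by fun_prop)) (fun z hz hzG ↦ by
      have e : F z - α * z = (F z - Ψ z) + (Ψ z - α * z) := by ring
      rw [e]
      exact add_mem (hFΨ z hz hzG) (hlin z hzG))
  have haff : ∀ ζ ∈ Metric.ball a ε, F ζ = α * ζ + β := fun ζ hζ ↦ by
    linear_combination hβ ζ hζ
  -- `℘₂'(F ζ) = 2 K ζ` on the ball (on `G` by construction, by density in general)
  have hK2 : EqOn (fun ζ ↦ ℘'[L₂] (F ζ)) (fun ζ ↦ 2 * K ζ) (Metric.ball a ε) := by
    refine Set.EqOn.of_subset_closure (s := Metric.ball a ε ∩ (G : Set ℂ)) ?_ ?_ ?_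
      inter_subset_left (hdense.open_subset_closure_inter Metric.isOpen_ball)
    · rintro ζ ⟨hζ, hζG⟩
      obtain ⟨-, -, h3⟩ := hΨU ζ (hsub hζ) hζG
      have hl := hFΨ ζ hζ hζG
      have e : ℘'[L₂] (F ζ) = ℘'[L₂] (Ψ ζ) := by
        have := L₂.derivWeierstrassP_add_coe (Ψ ζ) ⟨F ζ - Ψ ζ, hl⟩
        rw [← this]
        congr 1
        push_cast
        ring
      dsimp only
      rw [e, ← h3]
      ring
    · intro ζ hζ
      have hFζ := (hF℘ ζ hζ).1
      have h1 : ContinuousAt ℘'[L₂] (F ζ) := (L₂.analyticOnNhd_derivWeierstrassP _ hFζ).continuousAt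
      exact (h1.comp_continuousWithinAt (hFd.continuousOn ζ hζ) :)
    · exact (hKc.mono hsub).const_smul (2 : ℂ) |>.congr fun ζ _ ↦ by simp [smul_eq_mul]
  -- the identity on the ball
  have hball : ∀ ζ ∈ Metric.ball a ε,
      α * MvPolynomial.eval (v ζ) (MvPolynomial.C 2 * p₂ * q₁ ^ 2) =
        MvPolynomial.eval (v ζ)
          ((L₁.curve.invariantDerivation p₁ * q₁ - p₁ * L₁.curve.invariantDerivation q₁) * q₂) := by
    intro ζ hζ
    obtain ⟨hζΛ, hD₁ζ, hD₂ζ, -⟩ := hsub hζ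
    obtain ⟨hFζ, h℘F⟩ := hF℘ ζ hζ
    -- derivative of `℘₂ ∘ F`
    have hFder : HasDerivAt F α ζ := by
      have h0 : HasDerivAt (fun z ↦ α * z + β) α ζ := by
        simpa using ((hasDerivAt_id ζ).const_mul α).add_const β
      refine h0.congr_of_eventuallyEq ?_
      filter_upwards [Metric.isOpen_ball.mem_nhds hζ] with w hw using haff w hw
    have hcomp : HasDerivAt (fun z ↦ ℘[L₂] (F z)) (℘'[L₂] (F ζ) * α) ζ :=
      (L₂.hasDerivAt_weierstrassP hFζ).comp ζ hFder
    -- derivative of `R = N₁/D₁`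
    have hN₁d := L₁.hasDerivAt_eval_weierstrassP p₁ hζΛ
    have hD₁d := L₁.hasDerivAt_eval_weierstrassP q₁ hζΛ
    have hRder : HasDerivAt R
        ((MvPolynomial.eval (v ζ) (L₁.curve.invariantDerivation p₁) * D₁ ζ -
          N₁ ζ * MvPolynomial.eval (v ζ) (L₁.curve.invariantDerivation q₁)) / D₁ ζ ^ 2) ζ :=
      hN₁d.fun_div hD₁d hD₁ζ
    -- `℘₂ ∘ F = R` near `ζ`, so the derivatives agree
    have hcomp' : HasDerivAt R (℘'[L₂] (F ζ) * α) ζ := by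
      refine hcomp.congr_of_eventuallyEq ?_
      filter_upwards [Metric.isOpen_ball.mem_nhds hζ] with w hw using ((hF℘ w hw).2).symm
    have hderiv_eq := hRder.unique hcomp'
    have hK2ζ : ℘'[L₂] (F ζ) = 2 * K ζ := hK2 hζ
    rw [hK2ζ] at hderiv_eq
    simp only [hK, hN₂, hD₂, hN₁, hD₁] at hderiv_eq
    -- clear denominators
    have hD₁' : MvPolynomial.eval (v ζ) q₁ ≠ 0 := hD₁ζ
    have hD₂' : MvPolynomial.eval (v ζ) q₂ ≠ 0 := hD₂ζ
    rw [← mul_div_assoc, div_mul_eq_mul_div, div_eq_div_iff (pow_ne_zero 2 hD₁') hD₂'] at hderiv_eq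
    simp only [map_mul, map_pow, map_sub, MvPolynomial.eval_C]
    linear_combination -hderiv_eq
  -- identity theorem on `ℂ ∖ Λ₁`
  have hpre : IsPreconnected ((L₁.lattice : Set ℂ)ᶜ) :=
    (Set.Countable.isConnected_compl_of_one_lt_rank (by simp) L₁.countable_lattice).isPreconnected
  have hLan : AnalyticOnNhd ℂ
      (fun ζ ↦ α * MvPolynomial.eval (v ζ) (MvPolynomial.C 2 * p₂ * q₁ ^ 2))
      (L₁.lattice : Set ℂ)ᶜ := fun ζ hζ ↦ analyticAt_const.mul (han _ ζ hζ)
  have hRan := han ((L₁.curve.invariantDerivation p₁ * q₁ - p₁ * L₁.curve.invariantDerivation q₁) * q₂)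
  have hev : (fun ζ ↦ α * MvPolynomial.eval (v ζ) (MvPolynomial.C 2 * p₂ * q₁ ^ 2)) =ᶠ[𝓝 a]
      fun ζ ↦ MvPolynomial.eval (v ζ)
        ((L₁.curve.invariantDerivation p₁ * q₁ - p₁ * L₁.curve.invariantDerivation q₁) * q₂) := by
    filter_upwards [Metric.isOpen_ball.mem_nhds (Metric.mem_ball_self hε)] with ζ hζ
      using hball ζ hζ
  exact hLan.eqOn_of_preconnected_of_eventuallyEq hRan hpre ha1 hev hz


/-! ### From a homomorphism of curves `E_{Λ₁} ⊇ M₁ → M₂ ⊆ E_{Λ₂}` to the analytic core -/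

/-- **A rational homomorphism `E_{Λ₁} → E_{Λ₂}` is `z ↦ αz` with `α ≠ 0`, `αΛ₁ ⊆ Λ₂`, and `α`
is computed by the invariant derivation** (Silverman, *AEC*, Thm. VI.4.1(b) with the pull-back
of the invariant differential, III.5), in the elementary form used by the tree.  Let `M₁, M₂`
be abstract groups mapped injectively into `E_{Λ₁}(ℂ)`, `E_{Λ₂}(ℂ)` by `f₁, f₂`, the image of
`f₁` containing all torsion points and `M₁` infinite, and let `φ : M₁ →+ M₂` be an additive
map with finite kernel which, through `f₁, f₂`, is given off a finite set by a rational map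
`(x, y) ↦ (p₁/q₁, p₂/q₂)(x, y)`.  Then there is `α ∈ ℂ`, `α ≠ 0`, with `αΛ₁ ⊆ Λ₂`, such that
for **every** such rational representation `(p₁', q₁', p₂', q₂')` of `φ` and every `m ∈ M₁`
with `f₁ m = (x, y)` affine, `α · (2p₂'q₁'²)(x, y) = ((δp₁'·q₁' − p₁'·δq₁')·q₂')(x, y)`,
`δ = δ_{E_{Λ₁}}` (`WeierstrassCurve.invariantDerivation`).  (Apply `exists_mul_of_rational_lift₂`
and `mul_eval_eq_of_rational_of_linear` to `G = π₁⁻¹(f₁(M₁))`, `πᵢ : ℂ →+ E_{Λᵢ}(ℂ)` the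
parametrisations `z ↦ (℘ z, ℘' z/2)` of `ComplexTorus.lean`, and a lift `Ψ` of
`f₂ ∘ φ ∘ f₁⁻¹ ∘ π₁` through `π₂`; `α ≠ 0` because `φ ≠ 0`, `M₁` being infinite and `ker φ`
finite.)  In the application (`EichlerShimuraConstructionLatticeProofs.lean`) `Mᵢ = Eᵢ(ℚ̄)` for
models `Eᵢ/ℚ` of `E_{Λᵢ}`, `fᵢ` are induced by one embedding `ℚ̄ ↪ ℂ`, `φ` is a `ℚ`-isogeny, and
the displayed identity for a representation and its Galois conjugates shows `α ∈ ℚ`.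
[cite: SilvermanAEC2009, Thm. VI.4.1(b) (PDF pp. 152–154) and III.5 (PDF p. 75)] -/
theorem exists_mul_of_curve_hom (L₁ L₂ : PeriodPair) {M₁ M₂ : Type*} [AddCommGroup M₁]
    [AddCommGroup M₂] [Infinite M₁] (φ : M₁ →+ M₂) (hker : (φ.ker : Set M₁).Finite)
    {W₁ W₂ : WeierstrassCurve ℂ} (hW₁ : W₁ = L₁.curve) (hW₂ : W₂ = L₂.curve)
    (f₁ : M₁ →+ W₁.toAffine.Point) (hf₁ : Function.Injective f₁)
    (f₂ : M₂ →+ W₂.toAffine.Point) (hf₂ : Function.Injective f₂)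
    (htors : ∀ n : ℕ, 0 < n → ∀ P : W₁.toAffine.Point, n • P = 0 → P ∈ f₁.range)
    (p₁ q₁ p₂ q₂ : MvPolynomial (Fin 2) ℂ)
    (halg : {m : M₁ | ¬ ∃ (x y : ℂ) (h : W₁.toAffine.Nonsingular x y),
        f₁ m = .some x y h ∧ MvPolynomial.eval ![x, y] q₁ ≠ 0 ∧ MvPolynomial.eval ![x, y] q₂ ≠ 0 ∧
        ∃ h' : W₂.toAffine.Nonsingular
            (MvPolynomial.eval ![x, y] p₁ / MvPolynomial.eval ![x, y] q₁)
            (MvPolynomial.eval ![x, y] p₂ / MvPolynomial.eval ![x, y] q₂),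
          f₂ (φ m) = .some _ _ h'}.Finite) :
    ∃ α : ℂ, α ≠ 0 ∧ (∀ l ∈ L₁.lattice, α * l ∈ L₂.lattice) ∧
      ∀ (p₁' q₁' p₂' q₂' : MvPolynomial (Fin 2) ℂ),
        {m : M₁ | ¬ ∃ (x y : ℂ) (h : W₁.toAffine.Nonsingular x y),
          f₁ m = .some x y h ∧ MvPolynomial.eval ![x, y] q₁' ≠ 0 ∧
          MvPolynomial.eval ![x, y] q₂' ≠ 0 ∧
          ∃ h' : W₂.toAffine.Nonsingular
              (MvPolynomial.eval ![x, y] p₁' / MvPolynomial.eval ![x, y] q₁')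
              (MvPolynomial.eval ![x, y] p₂' / MvPolynomial.eval ![x, y] q₂'),
            f₂ (φ m) = .some _ _ h'}.Finite →
        ∀ (m : M₁) (x y : ℂ) (h : W₁.toAffine.Nonsingular x y), f₁ m = .some x y h →
          α * MvPolynomial.eval ![x, y] (MvPolynomial.C 2 * p₂' * q₁' ^ 2) =
            MvPolynomial.eval ![x, y]
              ((W₁.invariantDerivation p₁' * q₁' - p₁' * W₁.invariantDerivation q₁') * q₂') := by
  subst hW₁ hW₂
  classical
  set π₁ : ℂ →+ L₁.curve.toAffine.Point := toPointHom (toPoint_add_holds (L := L₁)) with hπ₁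
  have hπ₁app : ∀ z, π₁ z = L₁.toPoint z := fun z ↦ rfl
  -- the group `G = π₁⁻¹(f₁(M₁))` and the section `μ : G → M₁`
  set G : AddSubgroup ℂ := f₁.range.comap π₁ with hG
  have hmemG : ∀ z, z ∈ G ↔ ∃ m, f₁ m = L₁.toPoint z := fun z ↦ by
    simp only [hG, AddSubgroup.mem_comap, AddMonoidHom.mem_range, hπ₁app]
  set μ : ℂ → M₁ := fun z ↦ if h : ∃ m, f₁ m = L₁.toPoint z then h.choose else 0 with hμ
  have hμspec : ∀ z ∈ G, f₁ (μ z) = L₁.toPoint z := by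
    intro z hz
    have h := (hmemG z).1 hz
    simp only [hμ, dif_pos h]
    exact h.choose_spec
  have hμadd : ∀ z ∈ G, ∀ w ∈ G, μ (z + w) = μ z + μ w := by
    intro z hz w hw
    apply hf₁
    rw [map_add, hμspec z hz, hμspec w hw, hμspec (z + w) (G.add_mem hz hw)]
    exact toPoint_add_holds (L := L₁) z w
  have hμeq : ∀ m z, f₁ m = L₁.toPoint z → z ∈ G ∧ μ z = m := fun m z hz ↦ by
    have hzG : z ∈ G := (hmemG z).2 ⟨m, hz⟩
    exact ⟨hzG, hf₁ (by rw [hμspec z hzG, hz])⟩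
  -- the lift `Ψ` of `f₂ ∘ φ ∘ μ` through `π₂`
  set Ψ : ℂ → ℂ := fun z ↦ (L₂.toPoint_surjective (f₂ (φ (μ z)))).choose with hΨ
  have hΨspec : ∀ z, L₂.toPoint (Ψ z) = f₂ (φ (μ z)) := fun z ↦
    (L₂.toPoint_surjective (f₂ (φ (μ z)))).choose_spec
  have hadd : ∀ z ∈ G, ∀ w ∈ G, Ψ (z + w) - Ψ z - Ψ w ∈ L₂.lattice := by
    intro z hz w hw
    have h : L₂.toPoint (Ψ (z + w)) = L₂.toPoint (Ψ z + Ψ w) := by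
      rw [toPoint_add_holds (L := L₂), hΨspec, hΨspec, hΨspec, hμadd z hz w hw, map_add,
        map_add]
    have := L₂.toPoint_eq_toPoint_iff.1 h
    rwa [show Ψ (z + w) - (Ψ z + Ψ w) = Ψ (z + w) - Ψ z - Ψ w by ring] at this
  -- division points of `Λ₁` lie in `G`
  have hdiv : ∀ n : ℕ, 0 < n → ∀ l ∈ L₁.lattice, l / n ∈ G := by
    intro n hn l hl
    rw [hG, AddSubgroup.mem_comap]
    refine htors n hn _ ?_
    rw [← map_nsmul, hπ₁app, nsmul_eq_mul, mul_div_cancel₀ _ (by exact_mod_cast hn.ne')]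
    exact toPoint_of_mem hl
  -- every rational representation of `φ` yields a rational description of `Ψ` off finitely
  -- many cosets of `Λ₁`
  have hrep : ∀ (p₁' q₁' p₂' q₂' : MvPolynomial (Fin 2) ℂ),
      {m : M₁ | ¬ ∃ (x y : ℂ) (h : L₁.curve.toAffine.Nonsingular x y),
        f₁ m = .some x y h ∧ MvPolynomial.eval ![x, y] q₁' ≠ 0 ∧
        MvPolynomial.eval ![x, y] q₂' ≠ 0 ∧
        ∃ h' : L₂.curve.toAffine.Nonsingular
            (MvPolynomial.eval ![x, y] p₁' / MvPolynomial.eval ![x, y] q₁')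
            (MvPolynomial.eval ![x, y] p₂' / MvPolynomial.eval ![x, y] q₂'),
          f₂ (φ m) = .some _ _ h'}.Finite →
      ∃ T : Finset ℂ, ∀ z ∈ G, (∀ t ∈ T, z - t ∉ L₁.lattice) →
        z ∉ L₁.lattice ∧ Ψ z ∉ L₂.lattice ∧ ℘'[L₂] (Ψ z) ≠ 0 ∧
        MvPolynomial.eval ![℘[L₁] z, ℘'[L₁] z / 2] q₁' ≠ 0 ∧
        MvPolynomial.eval ![℘[L₁] z, ℘'[L₁] z / 2] q₂' ≠ 0 ∧
        ℘[L₂] (Ψ z) = MvPolynomial.eval ![℘[L₁] z, ℘'[L₁] z / 2] p₁' /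
          MvPolynomial.eval ![℘[L₁] z, ℘'[L₁] z / 2] q₁' ∧
        ℘'[L₂] (Ψ z) / 2 = MvPolynomial.eval ![℘[L₁] z, ℘'[L₁] z / 2] p₂' /
          MvPolynomial.eval ![℘[L₁] z, ℘'[L₁] z / 2] q₂' := by
    intro p₁' q₁' p₂' q₂' hSfin
    set S : Set M₁ := {m : M₁ | ¬ ∃ (x y : ℂ) (h : L₁.curve.toAffine.Nonsingular x y),
        f₁ m = .some x y h ∧ MvPolynomial.eval ![x, y] q₁' ≠ 0 ∧
        MvPolynomial.eval ![x, y] q₂' ≠ 0 ∧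
        ∃ h' : L₂.curve.toAffine.Nonsingular
            (MvPolynomial.eval ![x, y] p₁' / MvPolynomial.eval ![x, y] q₁')
            (MvPolynomial.eval ![x, y] p₂' / MvPolynomial.eval ![x, y] q₂'),
          f₂ (φ m) = .some _ _ h'} with hS
    -- the exceptional set: non-agreeing points, and points mapped to `E_{Λ₂}[2]`
    set E2 : Set L₂.curve.toAffine.Point :=
      (AddSubgroup.torsionBy L₂.curve.toAffine.Point ((2 : ℕ) : ℤ) : Set L₂.curve.toAffine.Point)
      with hE2
    have hE2fin : E2.Finite := by
      have hcard := WeierstrassCurve.card_torsionBy_eq_sq (E := L₂.curve) (n := 2) (by norm_num)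
      have : Finite (AddSubgroup.torsionBy L₂.curve.toAffine.Point ((2 : ℕ) : ℤ)) :=
        Nat.finite_of_card_ne_zero (by rw [hcard]; norm_num)
      exact Set.toFinite _
    set S₂ : Set M₁ := S ∪ φ ⁻¹' (f₂ ⁻¹' E2) with hS₂
    have hS₂fin : S₂.Finite :=
      hSfin.union (finite_preimage_of_finite_ker φ hker (hE2fin.preimage hf₂.injOn))
    -- lifts of the exceptional points to `ℂ`, and the finite set `T` of bad cosets
    set lift : L₁.curve.toAffine.Point → ℂ := fun P ↦ (L₁.toPoint_surjective P).choose with hlift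
    have hliftspec : ∀ P, L₁.toPoint (lift P) = P := fun P ↦ (L₁.toPoint_surjective P).choose_spec
    set Tset : Set ℂ := (fun m ↦ lift (f₁ m)) '' S₂ ∪ {0} with hTset
    have hTfin : Tset.Finite := (hS₂fin.image _).union (Set.finite_singleton 0)
    refine ⟨hTfin.toFinset, fun z hzG hzT ↦ ?_⟩
    have hmemT : ∀ t, t ∈ hTfin.toFinset ↔ t ∈ Tset := fun t ↦ hTfin.mem_toFinset
    have hz0 : z ∉ L₁.lattice := by
      have := hzT 0 ((hmemT 0).2 (Or.inr rfl))
      rwa [sub_zero] at this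
    set m₀ := μ z with hm₀
    have hm₀spec : f₁ m₀ = L₁.toPoint z := hμspec z hzG
    have hm₀S₂ : m₀ ∉ S₂ := by
      intro hmem
      have ht : lift (f₁ m₀) ∈ hTfin.toFinset := (hmemT _).2 (Or.inl ⟨m₀, hmem, rfl⟩)
      apply hzT _ ht
      apply L₁.toPoint_eq_toPoint_iff.1
      rw [hliftspec, hm₀spec]
    have hm₀S : m₀ ∉ S := fun h ↦ hm₀S₂ (Or.inl h)
    have hm₀E2 : f₂ (φ m₀) ∉ E2 := fun h ↦ hm₀S₂ (Or.inr h)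
    simp only [hS, mem_setOf_eq, not_not] at hm₀S
    obtain ⟨x, y, hxy, hfm, hq₁, hq₂, h', hfφ⟩ := hm₀S
    rw [hm₀spec, toPoint_of_notMem hz0] at hfm
    obtain ⟨rfl, rfl⟩ : x = ℘[L₁] z ∧ y = ℘'[L₁] z / 2 :=
      WeierstrassCurve.Affine.Point.some.inj hfm.symm
    have hΨz' : L₂.toPoint (Ψ z) = f₂ (φ m₀) := by rw [hm₀]; exact hΨspec z
    have hΨz := hΨz'
    rw [hfφ] at hΨz
    have hΨ0 : Ψ z ∉ L₂.lattice := by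
      intro hmem
      rw [toPoint_of_mem hmem] at hΨz
      exact (WeierstrassCurve.Affine.Point.some_ne_zero h') hΨz.symm
    rw [toPoint_of_notMem hΨ0] at hΨz
    obtain ⟨h℘, h℘'⟩ := WeierstrassCurve.Affine.Point.some.inj hΨz
    refine ⟨hz0, hΨ0, fun h0 ↦ hm₀E2 ?_, hq₁, hq₂, h℘, h℘'⟩
    -- `℘₂'(Ψ z) = 0` would make `f₂ (φ m₀) = π₂ (Ψ z)` a `2`-torsion point
    have hP : L₂.toPoint (Ψ z) = -L₂.toPoint (Ψ z) := by
      rw [toPoint_of_notMem hΨ0, WeierstrassCurve.Affine.Point.neg_some]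
      simp only [WeierstrassCurve.Affine.negY, WeierstrassCurve.toAffine, curve_a₁, curve_a₃]
      congr 1
      rw [h0]; ring
    rw [hE2, SetLike.mem_coe, AddSubgroup.torsionBy.nsmul_iff, ← hΨz', two_nsmul,
      add_eq_zero_iff_eq_neg]
    exact hP
  -- the multiplier `α`, from the given representation
  obtain ⟨T, hT⟩ := hrep p₁ q₁ p₂ q₂ halg
  obtain ⟨α, hαΛ, hlin⟩ := exists_mul_of_rational_lift₂ L₁ L₂ G hdiv Ψ hadd p₁ q₁ p₂ q₂ T hT
  -- `α ≠ 0`: otherwise `φ = 0` would have infinite kernel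
  have hα : α ≠ 0 := by
    intro hα0
    have hφ0 : ∀ m, φ m = 0 := by
      intro m
      obtain ⟨z, hz⟩ := L₁.toPoint_surjective (f₁ m)
      obtain ⟨hzG, hμz⟩ := hμeq m z hz.symm
      have h1 := hlin z hzG
      rw [hα0, zero_mul, sub_zero] at h1
      have h2 : L₂.toPoint (Ψ z) = 0 := toPoint_of_mem h1
      rw [hΨspec, hμz] at h2
      exact hf₂ (by rw [h2, map_zero])
    have huniv : (φ.ker : Set M₁) = Set.univ := by
      ext m
      simp [hφ0 m]
    rw [huniv] at hker
    exact Set.infinite_univ hker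
  refine ⟨α, hα, hαΛ, fun p₁' q₁' p₂' q₂' halg' m x y h hm ↦ ?_⟩
  obtain ⟨T', hT'⟩ := hrep p₁' q₁' p₂' q₂' halg'
  obtain ⟨z, hz⟩ := L₁.toPoint_surjective (f₁ m)
  have hz0 : z ∉ L₁.lattice := by
    intro hmem
    rw [toPoint_of_mem hmem, hm] at hz
    exact WeierstrassCurve.Affine.Point.some_ne_zero h hz.symm
  rw [toPoint_of_notMem hz0, hm] at hz
  obtain ⟨rfl, rfl⟩ : x = ℘[L₁] z ∧ y = ℘'[L₁] z / 2 :=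
    WeierstrassCurve.Affine.Point.some.inj hz.symm
  exact mul_eval_eq_of_rational_of_linear L₁ L₂ G hdiv Ψ hlin p₁' q₁' p₂' q₂' T' hT' hz0

end PeriodPair

end
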